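import Mathlib
import HarnessLib
import HarnessLib.Audit
import Summits.MatrixMultiplication.Statement
import Literature.Computability.AlgebraicComplexity.AsymptoticSpectrum
import Literature.Computability.AlgebraicComplexity.QuantumFunctionalPoint
import Literature.Computability.AlgebraicComplexity.TensorSemiringSpectrum
import Literature.Computability.AlgebraicComplexity.StrassenPreorder
import Literature.ModelTheory.ExponentialFields.RealExpField

/-!
Route: DarkPointsByLogic

CLOSED (retired) 2026-08-15T16:16:35Z by planner-rbadge-MatrixMultiplication-DarkPoints-9630f0f6-g4-0 — reason: not-a-thesis — note: not-a-thesis (route-repair rbadge-…-9630f0f6-g4, glue stamp). The target DarkPointAtTwo (∃ F ∈ Δ(ℂ) with F(⟨2,2,2⟩) > 4) is EQUIVALENT to ¬MatrixMultiplication by the PROVED tree theorems strassen_duality_asymptoticRank_holds + asymptoticRank_matMulTensor (max_F F(⟨2,2,2⟩) = R̃(⟨2,2,2⟩) = 2^ω, and 2. The file is kept as the record of this route; refuted decls are indexed as negative knowledge (`ledger negatives`).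

# Route DarkPointsByLogic — dark spectral points by logic — undecidable asymptotic restriction
forces non-quantum points; dual refutation target at ⟨2,2,2⟩

X_D (refutation line, spectral side; realises card dark-points-by-undecidability-rev): there is a
DARK POINT AT ⟨2,2,2⟩ — a universal
spectral point F of complex 3-tensors (tree: `IsUniversalSpectralPoint ℂ F`) with F(⟨2,2,2⟩) > 4. By
Strassen duality (PROVED in tree,
`strassen_duality_asymptoticRank_holds`) and R̃(⟨2,2,2⟩) = 2^ω (PROVED,
`asymptoticRank_matMulTensor`) X_D is the dual form of ω(ℂ) > 2,
the kill criterion every spectral positive route (AsymptoticSpectrum, IsotypicSaturation) names but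
no route works. Every quantum functional
reads exactly 4 at ⟨2,2,2⟩ (item QuantumValueAtMM2), so X_D needs a NON-QUANTUM universal spectral
point (item NonQuantumSpectralPoint =
ledger stmt-0583, shared). The card's engine manufactures such points WITHOUT writing one down: the
quantum side of Strassen's duality is
TAME (comparison of all F^θ on integer tensors is decidable — outright, crux
QuantumComparisonDecidable, or relative to Th(ℝ_exp), hence
under Schanuel by Macintyre–Wilkie, support QuantumComparisonDecidableOfRealExp), so if asymptotic
restriction of integer 3-tensors is
UNDECIDABLE (crux UndecidableAsymptoticRestriction, the card's thesis U) the quantum functionals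
cannot be all of Δ(ℂ) (support
DarkFromUndecidable, provable now from the tree's spectral theorem). Honest scope: U yields darkness
somewhere, not at ⟨2,2,2⟩; the
localisation step is NOT claimed and not filed (see Kill criteria / Not decomposed yet) — exactly as
route BorderRankLowerBound stages
necessary precursors of its X_F.
Lean: `∃ F : Literature.Computability.AlgebraicComplexity.SpectralMap ℂ,
Literature.Computability.AlgebraicComplexity.IsUniversalSpectralPoint ℂ F ∧ (4 : ℝ) < F
(Literature.Computability.AlgebraicComplexity.matMulTensor ℂ 2 2 2)`

## Assembly
Pure glue over PROVED facts (checked sorry-free in Sketch.lean modulo the two tree theorems): given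
F ∈ Δ(ℂ) with F(⟨2,2,2⟩) > 4,
`strassen_duality_asymptoticRank_holds` gives F(⟨2,2,2⟩) ≤ R̃(⟨2,2,2⟩),
`asymptoticRank_matMulTensor` gives R̃(⟨2,2,2⟩) = 2^{ω(ℂ)}, so
2^ω > 4, ω > 2, contradicting `MatrixMultiplication ↔ ω(ℂ) = 2`. The cruxes compose INTO the target
only informally: U ∧ QCD ⇒ 0583
(DarkFromUndecidable, typed) is necessary groundwork for X_D (QuantumValueAtMM2); localisation of
darkness at ⟨2,2,2⟩ is the open gap.

Rationale: WHY THIS LINE. The negative side of ω = 2 has one worked route (BorderRankLowerBound: equations of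
secant varieties, capped by rank-method barriers); this
line attacks the same dual object — a spectral point beyond the flattening value — from LOGIC:
Strassen's spectral theorem (Strassen1988
Thm 2.4 / Zuiddam2018 Thm 2.12, PROVED in tree as
`IsStrassenPreorder.asympLe_iff_forall_spectralPoint`) says s ≲ t iff F(s) ≤ F(t) for all
F ∈ Δ, and the KNOWN part of Δ(ℂ) — the quantum functionals F^θ (ChristandlVranaZuiddam2023 Cor
3.31, PROVED in tree; = support
functionals, SakabeDoganWalter2026 = arXiv:2601.21553) — is an effective family: moment polytopes of
rational tensors are computable
(arXiv:2510.08336, BurgisserChristandlMulmuleyWalter2017 (SIAM J. Comput. 46: membership in moment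
polytopes is in NP and coNP)) and "F^θ(s) ≤ F^θ(t) for all θ" is a sentence of ℝ_exp, decidable
relative to
`Literature.ModelTheory.ExponentialFields.RealExpDecidable` (MacintyreWilkie1996; the Schanuel
summit's Literature, a genuine cross-summit
import). Hence a complexity gap between ≲ (a Π⁰₂ predicate, support AsympLePi2Form) and its tame
shadow is an EXISTENCE PROOF of
non-quantum spectral points (refuting AsymptoticSpectrum 0582, proving 0583, and with
IsotypicSaturation.SaturatedPointsAreQuantum also its
DarkPolytopePoint). Engines for U are the halting/tiling encodings that made neighbouring asymptotic
tensor-power quantities undecidable: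
spectral gap (CubittPerezgarciaWolf2015 = doi:10.1038/nature16059), capacities of channels with
memory (ElkoussPerezGarcia2018 (Nature Communications 9 (2018) 1149: uncomputable capacity of
channels with memory)), tensor-stable
positivity (arXiv:2110.02113), MIP* = RE (arXiv:2001.04383). Imported areas: computability theory,
model theory of ℝ_exp (o-minimality /
Schanuel), quantum information; versus every other route and all 141 cards of the sub-problem (none
uses decidability; negatives index empty)
this is the only line that can produce dark points non-constructively.

RANKED CRUXES. #0 DarkPointAtTwo (target) — there is a universal spectral point F of complex
3-tensors with F(⟨2,2,2⟩) > 4 (dual form of ω > 2; the route's X_D). (why it might fail: ω may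
simply be 2 (then every F reads 4 at ⟨2,2,2⟩ by duality); and even with dark points elsewhere
nothing forces darkness at the 4×4×4 tensor ⟨2,2,2⟩.) [Strassen1988, ChristandlVranaZuiddam2023,
Blaser2013]
#2 UndecidableAsymptoticRestriction (crux) — THESIS U of the card: asymptotic restriction s ≲ t
(tree: `AsympLe (· ≤ ·)` on `TensorClass ℂ`, Zuiddam2018 Def 2.1/2.6) between 3-tensors with INTEGER
entries is undecidable — no computable predicate on codes (m, entries of s, entries of t ∈ ℤ^{m³},
cubic format m, zero-padding being class-preserving) decides `AsympLe (mk s) (mk t)`. [difficulty: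
open-problem] (why it might fail: Kronecker powers are S_N-symmetric, leaving no room for aperiodic
tilings; Δ restricted to any format-bounded subsemiring may be finite-dimensional/semialgebraic,
making ≲ decidable format by format (the dull middle) — no evidence for U exists.)
[doi:10.1038/nature16059, arXiv:2110.02113, ElkoussPerezGarcia2018 (Nature Communications 9 (2018)
1149: uncomputable capacity of channels with memory), arXiv:2001.04383, Zuiddam2018,
arXiv:2211.12319]
#3 NonQuantumSpectralPoint (crux) — (= ledger stmt-MatrixMultiplication-0583 verbatim, shared with
route AsymptoticSpectrum) NOT every universal spectral point of complex 3-tensors is a quantum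
functional F^θ, θ ∈ P([3]) — a non-quantum ("dark") point exists; necessary for DarkPointAtTwo by
QuantumValueAtMM2, and the conclusion of DarkFromUndecidable. [difficulty: open-problem] (why it
might fail: universality of the quantum functionals (CVZ2023 §1, open) may hold — every
finite-temperature candidate (Vrana2023, JensenVrana2020) loses ⊗-multiplicativity or monotonicity,
and no dark point is known in any format.) [arXiv:1709.07851, arXiv:2601.21553, Strassen1991]
#4 QuantumComparisonDecidable (crux) — THE TAME SIDE, unconditional: the comparison "F^θ(s) ≤ F^θ(t)
for every θ in the probability simplex" between integer 3-tensors (same coding as U; tree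
`quantumFunctionalPoint`) is a computable predicate — via computable moment polytopes plus an exact
decision procedure for the resulting entropy inequalities over the simplex WITHOUT Schanuel.
[difficulty: L] (why it might fail: tangency cases (max_Δ(s) θ·H = max_Δ(t) θ·H at an interior
non-rational θ) are exact transcendence questions about exponential polynomials; without Schanuel
only the ℝ_exp-relative version (support item) may be provable.) [MacintyreWilkie1996,
arXiv:2510.08336, BurgisserChristandlMulmuleyWalter2017 (SIAM J. Comput. 46: membership in moment
polytopes is in NP and coNP), arXiv:1709.07851]
#9 DarkFromUndecidable (support) — the card's central inference, provable now: U and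
QuantumComparisonDecidable imply NonQuantumSpectralPoint — if every F were some F^θ then, by the
tree's spectral theorem (`IsStrassenPreorder.asympLe_iff_forall_spectralPoint` with
`TensorClass.isStrassenPreorder`, `TensorClass.eval`/`spectralMapOf`) and CVZ Cor 3.31
(`isUniversalSpectralPoint_quantumFunctionalPoint`), the two coded predicates coincide pointwise, so
≲ would be computable. [difficulty: provable-now] [Zuiddam2018, ChristandlVranaZuiddam2023,
Strassen1988]
#9 QuantumComparisonDecidableOfRealExp (support) — the Macintyre–Wilkie form of the tame side: if
Th(ℝ_exp) is decidable (tree `RealExpDecidable`; follows from Schanuel's conjecture,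
MacintyreWilkie1996) then quantum-functional comparison of integer tensors is computable — moment
polytopes Δ(s), Δ(t) are computable rational polytopes and "∀θ: max_{p∈Δ(s)} θ·H(p) ≤ max_{q∈Δ(t)}
θ·H(q)" is (uniformly in the data) a sentence of ℝ_exp. [difficulty: XL] [MacintyreWilkie1996,
arXiv:2510.08336, BurgisserChristandlMulmuleyWalter2017 (SIAM J. Comput. 46: membership in moment
polytopes is in NP and coNP), ChristandlVranaZuiddam2023]
#9 QuantumValueAtMM2 (support) — every quantum functional reads exactly 4 at ⟨2,2,2⟩: F^θ(⟨2,2,2⟩) =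
4 for θ in the simplex (marginals of ⟨2,2,2⟩ are maximally mixed on ℂ⁴, so H_θ = 2 = the dimension
bound; tree `quantumEntropy_le`, `quantumEntropy_le_logQuantumFunctional`). Shows
NonQuantumSpectralPoint is NECESSARY for DarkPointAtTwo. [difficulty: provable-now]
[ChristandlVranaZuiddam2023, Strassen1991]
#9 AsympLePi2Form (support) — the arithmetical (Π⁰₂) normal form of the asymptotic preorder of any
Strassen preorder: a ≲ b iff for every k there are N ≥ 1 and r with a^N ≼ r·b^N and r·k^N < (k+1)^N
(minimal factors are submultiplicative; Fekete). This is the logical shape any hardness proof for U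
must realise (each instance a^N ≼ r b^N being decidable over ℂ by quantifier elimination).
[difficulty: provable-now] [Zuiddam2018, Strassen1988]

TWO-LAYER PLAN. U ⇐ EncodingGadget (a computable map M ↦ (s_M, t_M) of integer tensors from a fixed
undecidable problem — Wang tilings / halting — with
"s_M ≲ t_M iff M ∈ coProblem", degeneration ε → 0 and Kronecker powers playing the thermodynamic
limit as in doi:10.1038/nature16059) →
EncodingCorrect (both directions, the hard one via an explicit obstruction family) → U.
QuantumComparisonDecidable ⇐ MomentPolytopeComputable
(vertices of Δ(t) from integer t, arXiv:2510.08336 §3–4) → EntropyComparisonDecidable (∀θ inequality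
of two maxima of θ·H over rational
polytopes; strict cases by interval arithmetic, identity cases by unique factorisation, tangency
cases the crux) → QCD. NonQuantumSpectralPoint ⇐
DarkFromUndecidable (filed) once U and QCD close; alternatively ⇐
IsotypicSaturation.DarkPolytopePoint.

KILL CRITERIA. ω = 2 proved by any route refutes DarkPointAtTwo: close `refuted:DarkPointAtTwo`.
Universality (AsymptoticSpectrum 0582) proved refutes
NonQuantumSpectralPoint and with QuantumValueAtMM2 the target: close refuted. ¬U proved (an
algorithm deciding ≲ on integer 3-tensors)
refutes the card's engine: close `refuted:UndecidableAsymptoticRestriction` — unless the decision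
procedure is itself non-quantum, in which
case it EXHIBITS Δ(ℂ) beyond F^θ and the line pivots to reading F(⟨2,2,2⟩) off it.
QuantumComparisonDecidable refuted (comparison of
quantum functionals itself undecidable) does not close the route but kills the unconditional
inference: restate DarkFromUndecidable over
QuantumComparisonDecidableOfRealExp (Schanuel becomes load-bearing, declared). A theorem
"non-quantum points exist but all read 4 at
⟨2,2,2⟩" (0583 ∧ ¬X_D) closes the route with the census "darkness is real but harmless to ω".

NOT DECOMPOSED YET. The LOCALISATION step (0583 → DarkPointAtTwo) is deliberately NOT filed: the
card has no mechanism for it and it is plausibly false as an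
implication (ω may be 2 with dark points in large formats); it stays prose until U or 0583 moves.
Not filed either: Π⁰₂-HARDNESS of ≲
(stronger than U; needs a many-one reduction statement over `Nat.Partrec.Code`), the graph-spectrum
reduction (Shannon-capacity comparison
↦ tensor ≲, card C2: Mathlib lacks the strong product / Shannon capacity, and the order-embedding
may not exist), the format-3 dichotomy
(card C3 — on inspection NOT cheap: "quantum functionals decide ≲ among 3×3×3 tensors and units"
already implies cw₂ ≲ ⟨3⟩, i.e.
R̃(cw₂) = 3 and ω = 2, route AsymptoticRankCW), computability of R̃ / of ω (card §3: orthogonal to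
the summit — ω = 2 ⇒ computable,
ω non-computable ⇒ ω ≠ 2 is valid but strictly harder than the target), and the localisation of U to
the matrix-multiplication
subsemiring S_MM (its spectrum is a compact subset of [0,1]³ equal to the θ-triangle iff ω = 2,
Strassen1988, so "≲ undecidable on S_MM"
presupposes superquadratic lower bounds — target-hard, rejected).

CHEAPEST FALSIFIER. (a) LOOKUP: a complete EFFECTIVE description of an asymptotic spectrum with
unbounded local dimension in a neighbouring resource theory —
e.g. the asymptotic spectrum of LOCC transformations (arXiv:1807.05130) — whose comparison problem
is provably decidable from entropy data:
U loses its analogy base. (b) LOOKUP: Wigderson–Zuiddam's problem list; Blatter–Draisma–Rupniewski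
(arXiv:2211.12319, restriction is a
wqo over finite fields): any theorem deciding ≲ on a class rich enough to host computation kills U.
(c) LEMMA (refuters): for s,t of a
FIXED format show {(N,r) : s^{⊗N} ≤ r·t^{⊗N}} is eventually periodic/semilinear computably in (s,t)
— that decides ≲ format by format
and retires the engine. In this session `lit search` was unavailable (rc 75 twice); galaxy substring
searches ("undecidable asymptotic
spectrum tensors", "computability of Shannon capacity", "Shannon capacity computable", "asymptotic
restriction problem", "undecidability
of tensor") returned only arXiv:1807.05130 and arXiv:2110.02113 — no decidability result for ≲
found.

NUMBERS. R̃(⟨2,2,2⟩) = 2^ω ∈ [4, 2^2.3714]; Q̃(⟨2,2,2⟩) = 4; F^θ(⟨2,2,2⟩) = 4 for all θ (uniform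
marginals on ℂ⁴); flattening ranks of ⟨2,2,2⟩ all 4.
Spectral points restricted to the matrix-multiplication semiring are (e,h,l) ↦ e^a h^b l^c with 0 ≤
a,b,c ≤ 1, 2 ≤ a+b+c ≤ ω; = the
support-functional triangle iff ω = 2 (Strassen1988). ≲ is Π⁰₂ in the coding of U (AsympLePi2Form;
each instance decidable over ℂ by
quantifier elimination); ω is upper semicomputable (ω = inf_n log_n R(⟨n,n,n⟩)). Moment polytopes of
all 3×3×3 tensors: 28
(arXiv:2510.08336). Items at open: 9 (1 target, 3 cruxes, 4 support, 1 assembly).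

DEFINITION REQUESTS. None needed to elaborate: `AsympLe`, `TensorClass.mk`,
`IsUniversalSpectralPoint`, `quantumFunctionalPoint`, `RealExpDecidable`,
`ComputablePred` all exist (checked with `lean check`, rc 0). Nice-to-have (not filed): a named
coding `intTensorOfList m L : Fin m → Fin m →
Fin m → ℤ` in Literature/Computability/AlgebraicComplexity to shorten U/QCD, and the named fact
"moment polytopes of rational tensors are
computable" (arXiv:2510.08336) as a cite item for QuantumComparisonDecidableOfRealExp's prover.

Novelty: Searches (2026-08-15): `lit search "undecidable asymptotic restriction tensors asymptotic spectrum
decidability"` ×2 → rc 75 (searchd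
unavailable); `lit galaxy search --star all` for "undecidable asymptotic spectrum tensors" (0),
"computability of Shannon capacity" (0),
"Shannon capacity computable" (0), "asymptotic restriction problem" (1: arXiv:1807.05130
Jensen–Vrana, asymptotic spectrum of LOCC),
"undecidability of tensor" (1: arXiv:2110.02113 van der Eyden–Netzer–De las Cuevas, undecidability
of tensor-stable positivity);
`ledger idea list --problem MatrixMultiplication` (141 cards: decidability/computability only in
this card, its retired first filing, and the
retired definable-design-barrier / wqo-minimal-arc-violator / arithmetic-border-rank-ake /
proof-shape-modulus-localisation-computability,
none with an undecidability-to-dark-point inference); grep of all 24 Theses files of the sub-problem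
for decidab/comput (0); `ledger negatives`
(0); `lean search` confirming the cross-summit decls (RealExpDecidable, SchanuelRank, AsympLe
spectral theorem).
Nearest prior art found: doi:10.1038/nature16059 (CubittPerezgarciaWolf2015: halting encoded in a
thermodynamic-limit tensor-network
quantity), arXiv:2110.02113 (undecidability of an asymptotic tensor-power property of positive
maps), arXiv:1709.07851 /
arXiv:2601.21553 (the tame known spectrum: quantum = support functionals, with algorithms),
MacintyreWilkie1996 (Th(ℝ_exp) decidable under
Schanuel); the card's novelty audit  [refs: 10.1038/nature16059, 1807.05130, 2110.02113, 1709.07851, 2601.21553, doi:10.1038/nature16059, MacintyreWilkie1996]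

Barriers (technique_class: computability, model-theory, spectral-duality): - technique_class: computability, model-theory, spectral-duality
- Literature.Barriers.MatrixMultiplication.InfimumNotMinimumBarrier: respected — the assembly uses
R̃(⟨2,2,2⟩) = 2^ω (an infimum identity, proved) and never attainment; ω enters only through duality.
- Literature.Barriers.MatrixMultiplication.IrreversibilityBarrier: n/a — it caps UPPER-bound methods
through fixed intermediate tensors; this is a refutation line producing spectral points, the objects
that barrier is made of.
- Literature.Barriers.MatrixMultiplication.UniversalMethodBarrier: n/a for the same reason (bounds
ω_u of the universal method from above via asymptotic slice rank / quantum functionals — all TAME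
points, consistent with QuantumValueAtMM2); a dark point is by definition outside its instrument
set.
- Literature.Barriers.MatrixMultiplication.LinearRankMethodBarrier: n/a — no rank-method lower bound
is used; X_D asks for a monotone ⊗-multiplicative functional, not a flattening, so the 8n² cap on
rank methods (EGOW2018) does not bound it (it bounds only the gauge points).
- Literature.Barriers.MatrixMultiplication.RectangularBarrier, UnstableTensorBarrier,
TricoloredSumFreeBarrier, EquivoluminousBarrier, group-theoretic barriers
(Nilpotent/Normalizer/Quasirandom/YoungSubgroup): n/a (no design, no host group, no laser method).
- Honest limitation in lieu of a barrier: S_N-symmetry of Kronecker powers is the known obstruction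
to tiling encodings (crux 2's why-might-fail); and U does not localise dar

Novelty grade: new-combination — ROUTE REVIEW (refuter rreview b4b00054, 2026-08-15): all 9 decls ELABORATE (reconstruction W_MM.lean, rc 0; file not yet in tree), 18 automation probes on S/¬S close nothing; per-item briefings on 7572-7579 + 0583 (stamped). STRUCTURAL OBJECTION (for the planner; no item blocked — each statement is  (refuter refuter-rreview-route-CriticalPhenomena--b4b00054-0, 2026-08-15T14:04:47Z; prior: doi:10.1038/nature16059, arXiv:2110.02113, arXiv:1709.07851, arXiv:2601.21553, MacintyreWilkie1996, arXiv:2510.08336, arXiv:1807.05130)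

History (route lifecycle, newest last):
- 2026-08-15T16:16:36Z · CLOSED retired — not-a-thesis (planner-rbadge-MatrixMultiplication-DarkPoints-9630f0f6-g4-0)

sub-problem: MatrixMultiplication · status: closed(retired) · opened planner-plancard-MatrixMultiplication-MatrixM-b3b83b03-0 2026-08-15T12:12:04Z · rev 1 · ledger route-MatrixMultiplication-DarkPointsByLogic
GENERATED by the gate from the ledger (D-0016/17). Provers cite these decls: `theorem foo : Summit.MatrixMultiplication.MatrixMultiplication.Theses.DarkPointsByLogic.<Decl> := …` in Summits/MatrixMultiplication/MatrixMultiplication/Theorems/<Name>.lean.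
-/

namespace Summit.MatrixMultiplication.MatrixMultiplication.Theses.DarkPointsByLogic

open scoped BigOperators Topology Manifold Classical MeasureTheory ProbabilityTheory Matrix InnerProductSpace ComplexConjugate ContinuousMap
open Filter Set Function TopologicalSpace MeasureTheory

attribute [summit_statement] _root_.MatrixMultiplication

/-- item stmt-MatrixMultiplication-7572 · target · rank 0 · closed · moot by None · by planner
why it might fail: ω may simply be 2 (then every F reads 4 at ⟨2,2,2⟩ by duality); and even with dark points elsewhere nothing forces darkness at the 4×4×4 tensor ⟨2,2,2⟩.
sources: Strassen1988, ChristandlVranaZuiddam2023, Blaser2013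
[target] there is a universal spectral point F of complex 3-tensors with F(⟨2,2,2⟩) > 4 (dual form
of ω > 2; the route's X_D). -/
@[route_item "route-MatrixMultiplication-DarkPointsByLogic"]
def DarkPointAtTwo : Prop :=
  ∃ F : Literature.Computability.AlgebraicComplexity.SpectralMap ℂ, Literature.Computability.AlgebraicComplexity.IsUniversalSpectralPoint ℂ F ∧ (4 : ℝ) < F (Literature.Computability.AlgebraicComplexity.matMulTensor ℂ 2 2 2)

/-- item stmt-MatrixMultiplication-7573 · crux · rank 2 · closed · moot by None · by planner
why it might fail: Kronecker powers are S_N-symmetric, leaving no room for aperiodic tilings; Δ restricted to any format-bounded subsemiring may be finite-dimensional/semialgebraic, making ≲ decidable format by format (the dull middle) — no evidence for U exists.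
sources: doi:10.1038/nature16059, arXiv:2110.02113, ElkoussPerezGarcia2018 (Nature Communications 9 (2018) 1149: uncomputable capacity of channels with memory), arXiv:2001.04383, Zuiddam2018, arXiv:2211.12319
[crux] THESIS U of the card: asymptotic restriction s ≲ t (tree: `AsympLe (· ≤ ·)` on `TensorClass
ℂ`, Zuiddam2018 Def 2.1/2.6) between 3-tensors with INTEGER entries is undecidable — no computable
predicate on codes (m, entries of s, entries of t ∈ ℤ^{m³}, cubic format m, zero-padding being
class-preserving) decides `AsympLe (mk s) (mk t)`. [difficulty: open-problem] -/
@[route_item "route-MatrixMultiplication-DarkPointsByLogic"]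
def UndecidableAsymptoticRestriction : Prop :=
  ¬ ComputablePred (fun x : ℕ × List ℤ × List ℤ => Literature.Computability.AlgebraicComplexity.AsympLe (· ≤ ·) (Literature.Computability.AlgebraicComplexity.TensorClass.mk (fun i j k : Fin x.1 => ((x.2.1.getD (i.val * x.1 * x.1 + j.val * x.1 + k.val) 0 : ℤ) : ℂ))) (Literature.Computability.AlgebraicComplexity.TensorClass.mk (fun i j k : Fin x.1 => ((x.2.2.getD (i.val * x.1 * x.1 + j.val * x.1 + k.val) 0 : ℤ) : ℂ))))

/-- item stmt-MatrixMultiplication-0583 · crux · rank 3 · closed · moot by None · by planner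
why it might fail: universality of the quantum functionals (CVZ2023 §1, open) may hold — every finite-temperature candidate (Vrana2023, JensenVrana2020) loses ⊗-multiplicativity or monotonicity, and no dark point is known in any format.
sources: arXiv:1709.07851, arXiv:2601.21553, Strassen1991
NEGATION of A_quantum_universality: there is a universal spectral point F of complex 3-tensors and a
tensor t with F(t) ≠ F^θ(t) for every θ ∈ P([3]) (a non-quantum spectral point). If moreover
F(<2,2,2>) > 4 this refutes ω = 2; if F ≤ max flattening rank everywhere it is harmless to X_A. File
as its own target: either answer re-ranks the route. -/
@[route_item "route-MatrixMultiplication-DarkPointsByLogic"]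
def NonQuantumSpectralPoint : Prop :=
  ¬ (∀ F : Literature.Computability.AlgebraicComplexity.SpectralMap ℂ, Literature.Computability.AlgebraicComplexity.IsUniversalSpectralPoint ℂ F → ∃ θ ∈ stdSimplex ℝ (Fin 3), ∀ ⦃ι κ μ : Type⦄ [Fintype ι] [Fintype κ] [Fintype μ] (t : ι → κ → μ → ℂ), F t = Literature.Computability.AlgebraicComplexity.quantumFunctionalPoint θ t)

/-- item stmt-MatrixMultiplication-7574 · crux · rank 4 · closed · moot by None · by planner
why it might fail: tangency cases (max_Δ(s) θ·H = max_Δ(t) θ·H at interior non-rational θ) are open effective transcendence (rreview b4b00054: 'L' is mis-rated); without Schanuel only the Th(ℝ_exp)-relative form QuantumComparisonDecidableOfRealExp may be provable.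
sources: MacintyreWilkie1996, arXiv:2510.08336, BurgisserChristandlMulmuleyWalter2017 (SIAM J. Comput. 46: membership in moment polytopes is in NP and coNP), arXiv:1709.07851
[crux] THE TAME SIDE, unconditional: the comparison "F^θ(s) ≤ F^θ(t) for every θ in the probability
simplex" between integer 3-tensors (same coding as U; tree `quantumFunctionalPoint`) is a computable
predicate — via computable moment polytopes plus an exact decision procedure for the resulting
entropy inequalities over the simplex WITHOUT Schanuel. [difficulty: L] -/
@[route_item "route-MatrixMultiplication-DarkPointsByLogic"]
def QuantumComparisonDecidable : Prop :=
  ComputablePred (fun x : ℕ × List ℤ × List ℤ => ∀ θ ∈ stdSimplex ℝ (Fin 3), Literature.Computability.AlgebraicComplexity.quantumFunctionalPoint θ (fun i j k : Fin x.1 => ((x.2.1.getD (i.val * x.1 * x.1 + j.val * x.1 + k.val) 0 : ℤ) : ℂ)) ≤ Literature.Computability.AlgebraicComplexity.quantumFunctionalPoint θ (fun i j k : Fin x.1 => ((x.2.2.getD (i.val * x.1 * x.1 + j.val * x.1 + k.val) 0 : ℤ) : ℂ)))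

/-- item stmt-MatrixMultiplication-7575 · support · rank 9 · closed · moot by None · by planner
sources: Zuiddam2018, ChristandlVranaZuiddam2023, Strassen1988
[support] the card's central inference, provable now: U and QuantumComparisonDecidable imply
NonQuantumSpectralPoint — if every F were some F^θ then, by the tree's spectral theorem
(`IsStrassenPreorder.asympLe_iff_forall_spectralPoint` with `TensorClass.isStrassenPreorder`,
`TensorClass.eval`/`spectralMapOf`) and CVZ Cor 3.31
(`isUniversalSpectralPoint_quantumFunctionalPoint`), the two coded predicates coincide pointwise, so
≲ would be computable. [difficulty: provable-now] -/
@[route_item "route-MatrixMultiplication-DarkPointsByLogic"]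
def DarkFromUndecidable : Prop :=
  UndecidableAsymptoticRestriction → QuantumComparisonDecidable → NonQuantumSpectralPoint

/-- item stmt-MatrixMultiplication-7576 · support · rank 9 · closed · moot by None · by planner
sources: MacintyreWilkie1996, arXiv:2510.08336, BurgisserChristandlMulmuleyWalter2017 (SIAM J. Comput. 46: membership in moment polytopes is in NP and coNP), ChristandlVranaZuiddam2023
[support] the Macintyre–Wilkie form of the tame side: if Th(ℝ_exp) is decidable (tree
`RealExpDecidable`; follows from Schanuel's conjecture, MacintyreWilkie1996) then quantum-functional
comparison of integer tensors is computable — moment polytopes Δ(s), Δ(t) are computable rational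
polytopes and "∀θ: max_{p∈Δ(s)} θ·H(p) ≤ max_{q∈Δ(t)} θ·H(q)" is (uniformly in the data) a sentence
of ℝ_exp. [difficulty: XL] -/
@[route_item "route-MatrixMultiplication-DarkPointsByLogic"]
def QuantumComparisonDecidableOfRealExp : Prop :=
  Literature.ModelTheory.ExponentialFields.RealExpDecidable → QuantumComparisonDecidable

/-- item stmt-MatrixMultiplication-7577 · support · rank 9 · closed · moot by None · by planner
sources: ChristandlVranaZuiddam2023, Strassen1991
[support] every quantum functional reads exactly 4 at ⟨2,2,2⟩: F^θ(⟨2,2,2⟩) = 4 for θ in the simplex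
(marginals of ⟨2,2,2⟩ are maximally mixed on ℂ⁴, so H_θ = 2 = the dimension bound; tree
`quantumEntropy_le`, `quantumEntropy_le_logQuantumFunctional`). Shows NonQuantumSpectralPoint is
NECESSARY for DarkPointAtTwo. [difficulty: provable-now] -/
@[route_item "route-MatrixMultiplication-DarkPointsByLogic"]
def QuantumValueAtMM2 : Prop :=
  ∀ θ ∈ stdSimplex ℝ (Fin 3), Literature.Computability.AlgebraicComplexity.quantumFunctionalPoint θ (Literature.Computability.AlgebraicComplexity.matMulTensor ℂ 2 2 2) = 4

/-- item stmt-MatrixMultiplication-7578 · support · rank 9 · closed · moot by None · by planner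
sources: Zuiddam2018, Strassen1988
[support] the arithmetical (Π⁰₂) normal form of the asymptotic preorder of any Strassen preorder: a
≲ b iff for every k there are N ≥ 1 and r with a^N ≼ r·b^N and r·k^N < (k+1)^N (minimal factors are
submultiplicative; Fekete). This is the logical shape any hardness proof for U must realise (each
instance a^N ≼ r b^N being decidable over ℂ by quantifier elimination). [difficulty: provable-now] -/
@[route_item "route-MatrixMultiplication-DarkPointsByLogic"]
def AsympLePi2Form : Prop :=
  ∀ (S : Type) [CommSemiring S] (le : S → S → Prop), Literature.Computability.AlgebraicComplexity.IsStrassenPreorder le → ∀ a b : S, (Literature.Computability.AlgebraicComplexity.AsympLe le a b ↔ ∀ k : ℕ, ∃ N r : ℕ, 1 ≤ N ∧ le (a ^ N) ((r : S) * b ^ N) ∧ r * k ^ N < (k + 1) ^ N)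

/-- item stmt-MatrixMultiplication-7579 · assembly · rank 1 · closed · moot by None · by planner
sources: Strassen1988, ChristandlVranaZuiddam2023, Blaser2013
[assembly] DarkPointAtTwo → ¬ MatrixMultiplication (ω(ℂ) = 2 is false if a universal spectral point
exceeds 4 at ⟨2,2,2⟩). -/
@[route_item "route-MatrixMultiplication-DarkPointsByLogic"]
def Assembly : Prop :=
  DarkPointAtTwo → ¬ MatrixMultiplication

end Summit.MatrixMultiplication.MatrixMultiplication.Theses.DarkPointsByLogic
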